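import Summits.AtomisticToContinuum.BoseEinsteinCondensation.Theses.BECSwapNoCatastrophe
import Literature.MathematicalPhysics.QuantumManyBody.HalfSwapTwoCopyForm
import HarnessLib

/-!
# Crux `TorusHalfSwapOverlap` (stmt-AtomisticToContinuum-14393), line `birth`,
stub `stub_symmetricInfimum`

Route `BECSwapNoCatastrophe` (sub-problem `BoseEinsteinCondensation`). Fixed-`n` stub: swap
invariance of the half-swapped two-copy form implies that its infimum over the swap-SYMMETRIC
admissible class equals its infimum over the absolute admissible class — the near-minimiser form
of "the positive ground state of the `F`-invariant stoquastic `H(½)` is `F`-symmetric", proved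
WITHOUT Perron–Frobenius, for every pair potential `v` (hard cores allowed), every `n` and `L`.

Proof (abstract form `SymmetricInfimum.iInf_symm_eq_iInf`, any measure `μ`, measurable weight
`W`, involution `F`, class `Per` stable under pointwise operations): for an admissible `Θ` put
`g± = Θ ± Θ∘F`. By the PARALLELOGRAM LAW (`form_add_add_sub`, `lintegral_nnnorm_add_sub` of
`Literature/…/HalfSwapTwoCopyForm.lean`) `q(g₊) + q(g₋) = 4 q(Θ)` and `‖g₊‖² + ‖g₋‖² = 4`. The
symmetric branch `g₊` is an unnormalised member of the symmetric class, so
`inf_sym · ‖g₊‖² ≤ q(g₊)` (`mul_lintegral_le_form_of_symm`). The ANTIsymmetric branch `g₋` is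
smoothed diamagnetically: the regularised moduli `h_ε = √(ε² + |g₋|²) − ε` are `C¹`, periodic and
`F`-symmetric (`|g₋∘F| = |g₋|`), with `q(h_ε) ≤ q(g₋)` (convexity inequality for gradients,
`form_sqrtReg_le`) and `‖h_ε‖² → ‖g₋‖²` (`tendsto_lintegral_nnnorm_sqrtReg_sq`), whence
`inf_sym · ‖g₋‖² ≤ q(g₋)` (`mul_lintegral_le_form_of_antisym`). Adding the two branches and
cancelling `4` gives `inf_sym ≤ q(Θ)`.

This file proves the REGISTERED stub signature verbatim (tree vocabulary, the two-copy objects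
inlined as `let`s exactly as in the route decls), under the registered name, in the line's
namespace; it cannot import the `Cruxes/` skeleton, which reads it back definitionally.

References: [LSSY2005] Lieb–Seiringer–Solovej–Yngvason, *The Mathematics of the Bose Gas and its
Condensation*, Ch. 2 (bosonic = absolute ground-state energy); [LiebLoss2001] Lieb–Loss,
*Analysis*, Thm. 7.8.
-/

noncomputable section

open MeasureTheory Filter Topology
open scoped ENNReal NNReal BigOperators ComplexConjugate

namespace Summit.AtomisticToContinuum.BoseEinsteinCondensation.Cruxes.TorusHalfSwapOverlap.Birth

open Literature.MathematicalPhysics.QuantumManyBody.BoseGas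
open Literature.MathematicalPhysics.QuantumManyBody.BoseGas.HalfSwapForm

/-! ### The abstract infimum argument -/

namespace SymmetricInfimum

variable {M : ℕ}

/-- **Variational principle for unnormalised symmetric trial functions.** If `e` lies below
`q` on the normalised members of a class of `C¹` functions closed under real scaling (here: `C¹`,
`Per`, `F`-symmetric), then `e · ‖g‖² ≤ q(g)` for every member `g` of the class with
`‖g‖² < ∞` (normalise `g`; nothing to prove if `‖g‖² = 0`). [folklore] -/
theorem mul_lintegral_le_form_of_symm (μ : Measure (Config M × Config M))
    (E : (Config M × Config M → ℂ) → ℝ≥0∞)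
    (hEc : ∀ c : ℝ, 0 ≤ c → ∀ Θ : Config M × Config M → ℂ, ContDiff ℝ 1 Θ →
      E (fun Z => (c : ℂ) * Θ Z) = ENNReal.ofReal (c ^ 2) * E Θ)
    (F : Config M × Config M → Config M × Config M) (Per : (Config M × Config M → ℂ) → Prop)
    (hPer : ∀ (G : ℂ → ℂ → ℂ) (Θ Φ : Config M × Config M → ℂ), Per Θ → Per Φ →
      Per fun Z => G (Θ Z) (Φ Z))
    (e : ℝ≥0∞)
    (he : ∀ Θ : Config M × Config M → ℂ, ContDiff ℝ 1 Θ → Per Θ →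
      (∀ X Y, Θ (F (X, Y)) = Θ (X, Y)) → ∫⁻ Z, ((‖Θ Z‖₊ : ℝ≥0∞)) ^ 2 ∂μ = 1 → e ≤ E Θ)
    {g : Config M × Config M → ℂ} (hg : ContDiff ℝ 1 g) (hgP : Per g)
    (hgS : ∀ X Y, g (F (X, Y)) = g (X, Y)) (htop : ∫⁻ Z, ((‖g Z‖₊ : ℝ≥0∞)) ^ 2 ∂μ ≠ ⊤) :
    e * ∫⁻ Z, ((‖g Z‖₊ : ℝ≥0∞)) ^ 2 ∂μ ≤ E g := by
  set m := ∫⁻ Z, ((‖g Z‖₊ : ℝ≥0∞)) ^ 2 ∂μ with hm_def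
  rcases eq_or_ne m 0 with hm0 | hm0
  · simp [hm0]
  have hmpos : 0 < m.toReal := ENNReal.toReal_pos hm0 htop
  set c : ℝ := Real.sqrt (m.toReal)⁻¹ with hc_def
  have hc0 : 0 ≤ c := Real.sqrt_nonneg _
  have hc2 : ENNReal.ofReal (c ^ 2) = m⁻¹ := by
    rw [hc_def, Real.sq_sqrt (inv_nonneg.2 hmpos.le), ENNReal.ofReal_inv_of_pos hmpos,
      ENNReal.ofReal_toReal htop]
  have h1 : ∫⁻ Z, ((‖(c : ℂ) * g Z‖₊ : ℝ≥0∞)) ^ 2 ∂μ = 1 := by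
    simp only [ennorm_real_mul_sq c hc0]
    rw [lintegral_const_mul' _ _ ENNReal.ofReal_ne_top, hc2]
    exact ENNReal.inv_mul_cancel hm0 htop
  calc e * m ≤ E (fun Z => (c : ℂ) * g Z) * m :=
        mul_le_mul_left (he _ (contDiff_const.mul hg) (hPer (fun w _ => (c : ℂ) * w) g g hgP hgP)
          (fun X Y => by simp only [hgS]) h1) m
    _ = E g := by
        rw [hEc c hc0 g hg, hc2, mul_comm, ← mul_assoc, ENNReal.mul_inv_cancel hm0 htop, one_mul]

/-- **The antisymmetric branch.** If `e` lies below `q` on the normalised `C¹`, `Per`,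
`F`-symmetric functions, then `e · ‖g‖² ≤ q(g)` also for every `C¹`, `Per`, `F`-ANTIsymmetric `g`
with `‖g‖² < ∞`: the regularised moduli `√(ε²+|g|²) − ε` are `C¹`, `Per`, `F`-symmetric, have
form `≤ q(g)` and norm `→ ‖g‖²`. [cite: LSSY2005, Ch. 2 (bosons: remark after (2.1))] -/
theorem mul_lintegral_le_form_of_antisym (μ : Measure (Config M × Config M))
    {W : Config M × Config M → ℝ≥0∞} (E : (Config M × Config M → ℂ) → ℝ≥0∞)
    (hE : ∀ Θ, E Θ = ∫⁻ Z, (kineticDensity (fun X => Θ (X, Z.2)) Z.1 +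
      kineticDensity (fun Y => Θ (Z.1, Y)) Z.2 + W Z * ((‖Θ Z‖₊ : ℝ≥0∞)) ^ 2) ∂μ)
    (F : Config M × Config M → Config M × Config M) (Per : (Config M × Config M → ℂ) → Prop)
    (hPer : ∀ (G : ℂ → ℂ → ℂ) (Θ Φ : Config M × Config M → ℂ), Per Θ → Per Φ →
      Per fun Z => G (Θ Z) (Φ Z))
    (e : ℝ≥0∞)
    (he : ∀ Θ : Config M × Config M → ℂ, ContDiff ℝ 1 Θ → Per Θ →
      (∀ X Y, Θ (F (X, Y)) = Θ (X, Y)) → ∫⁻ Z, ((‖Θ Z‖₊ : ℝ≥0∞)) ^ 2 ∂μ = 1 → e ≤ E Θ)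
    {g : Config M × Config M → ℂ} (hg : ContDiff ℝ 1 g) (hgP : Per g)
    (hgA : ∀ Z, g (F Z) = -g Z) (htop : ∫⁻ Z, ((‖g Z‖₊ : ℝ≥0∞)) ^ 2 ∂μ ≠ ⊤) :
    e * ∫⁻ Z, ((‖g Z‖₊ : ℝ≥0∞)) ^ 2 ∂μ ≤ E g := by
  -- every regularised modulus `√(ε² + |g|²) − ε` is an admissible SYMMETRIC trial function
  have hreg : ∀ {ε : ℝ}, 0 < ε →
      e * ∫⁻ Z, ((‖((Real.sqrt (ε ^ 2 + ‖g Z‖ ^ 2) - ε : ℝ) : ℂ)‖₊ : ℝ≥0∞)) ^ 2 ∂μ ≤ E g := by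
    intro ε hε
    have hS : ∀ X Y, ((Real.sqrt (ε ^ 2 + ‖g (F (X, Y))‖ ^ 2) - ε : ℝ) : ℂ) =
        ((Real.sqrt (ε ^ 2 + ‖g (X, Y)‖ ^ 2) - ε : ℝ) : ℂ) := fun X Y => by rw [hgA, norm_neg]
    have htop' : ∫⁻ Z, ((‖((Real.sqrt (ε ^ 2 + ‖g Z‖ ^ 2) - ε : ℝ) : ℂ)‖₊ : ℝ≥0∞)) ^ 2 ∂μ ≠ ⊤ :=
      ne_top_of_le_ne_top htop (lintegral_mono fun Z => nnnorm_sqrtReg_sq_le (g Z) hε)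
    exact (mul_lintegral_le_form_of_symm μ E (fun c hc Θ hΘ => form_const_mul μ E hE hΘ c hc) F Per
      hPer e he (contDiff_ofReal_sqrtReg hg hε)
      (hPer (fun w _ => ((Real.sqrt (ε ^ 2 + ‖w‖ ^ 2) - ε : ℝ) : ℂ)) g g hgP hgP) hS htop').trans
      (form_sqrtReg_le μ E hE hg hε)
  rcases eq_or_ne (∫⁻ Z, ((‖g Z‖₊ : ℝ≥0∞)) ^ 2 ∂μ) 0 with hm0 | hm0
  · rw [hm0, mul_zero]
    exact bot_le
  exact le_of_tendsto' (ENNReal.Tendsto.const_mul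
    (tendsto_lintegral_nnnorm_sqrtReg_sq μ hg.continuous htop) (Or.inl hm0))
    fun m => hreg Nat.one_div_pos_of_nat

/-- **`F`-symmetric infimum = absolute infimum** (abstract form). Let `q Θ = ∫ (|∇_X Θ|² +
|∇_Y Θ|² + W|Θ|²) dμ` on `(ℝ³)^M × (ℝ³)^M`, `F` an involution of the configuration space and
`Per` a class of functions stable under pointwise binary operations, such that `Θ ↦ Θ ∘ F`
preserves `C¹ ∧ Per ∧ (‖Θ‖ = 1)` and `q`. Then the infimum of `q` over the normalised `C¹`, `Per`,
`F`-symmetric `Θ` equals its infimum over the normalised `C¹`, `Per` `Θ`. Proof: for admissible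
`Θ` put `g± = Θ ± Θ∘F`; by the parallelogram law `q(g₊) + q(g₋) = 4 q(Θ)` and
`‖g₊‖² + ‖g₋‖² = 4`; the symmetric `g₊` gives `inf · ‖g₊‖² ≤ q(g₊)` by normalisation, the
antisymmetric `g₋` gives `inf · ‖g₋‖² ≤ q(g₋)` by `mul_lintegral_le_form_of_antisym`; add and
cancel `4`.
[cite: LSSY2005, Ch. 2 (bosons: remark after (2.1))] -/
theorem iInf_symm_eq_iInf (μ : Measure (Config M × Config M)) {W : Config M × Config M → ℝ≥0∞}
    (hW : Measurable W) (E : (Config M × Config M → ℂ) → ℝ≥0∞)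
    (hE : ∀ Θ, E Θ = ∫⁻ Z, (kineticDensity (fun X => Θ (X, Z.2)) Z.1 +
      kineticDensity (fun Y => Θ (Z.1, Y)) Z.2 + W Z * ((‖Θ Z‖₊ : ℝ≥0∞)) ^ 2) ∂μ)
    (F : Config M × Config M → Config M × Config M) (hF : ∀ Z, F (F Z) = Z)
    (Per : (Config M × Config M → ℂ) → Prop)
    (hPer : ∀ (G : ℂ → ℂ → ℂ) (Θ Φ : Config M × Config M → ℂ), Per Θ → Per Φ →
      Per fun Z => G (Θ Z) (Φ Z))
    (hinv : ∀ Θ : Config M × Config M → ℂ, ContDiff ℝ 1 Θ → Per Θ →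
      ∫⁻ Z, ((‖Θ Z‖₊ : ℝ≥0∞)) ^ 2 ∂μ = 1 →
      (ContDiff ℝ 1 (fun Z => Θ (F Z)) ∧ Per (fun Z => Θ (F Z)) ∧
          ∫⁻ Z, ((‖Θ (F Z)‖₊ : ℝ≥0∞)) ^ 2 ∂μ = 1) ∧ E (fun Z => Θ (F Z)) = E Θ) :
    (⨅ (Θ : Config M × Config M → ℂ) (_ : ContDiff ℝ 1 Θ ∧ Per Θ ∧
        (∀ X Y, Θ (F (X, Y)) = Θ (X, Y)) ∧ ∫⁻ Z, ((‖Θ Z‖₊ : ℝ≥0∞)) ^ 2 ∂μ = 1), E Θ) =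
      ⨅ (Θ : Config M × Config M → ℂ) (_ : ContDiff ℝ 1 Θ ∧ Per Θ ∧
        ∫⁻ Z, ((‖Θ Z‖₊ : ℝ≥0∞)) ^ 2 ∂μ = 1), E Θ := by
  refine le_antisymm (le_iInf₂ fun Θ hΘ => ?_)
    (le_iInf₂ fun Θ hΘ => iInf₂_le Θ ⟨hΘ.1, hΘ.2.1, hΘ.2.2.2⟩)
  -- abstract the symmetric infimum into a lower bound `e`
  suffices key : ∀ e : ℝ≥0∞, (∀ Θ' : Config M × Config M → ℂ, ContDiff ℝ 1 Θ' → Per Θ' →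
      (∀ X Y, Θ' (F (X, Y)) = Θ' (X, Y)) → ∫⁻ Z, ((‖Θ' Z‖₊ : ℝ≥0∞)) ^ 2 ∂μ = 1 → e ≤ E Θ') →
      e ≤ E Θ from key _ fun Θ' h1 h2 h3 h4 => iInf₂_le Θ' ⟨h1, h2, h3, h4⟩
  intro e he
  obtain ⟨hC, hP, hN⟩ := hΘ
  obtain ⟨⟨hCF, hPF, hNF⟩, hEF⟩ := hinv Θ hC hP hN
  have hEc : ∀ c : ℝ, 0 ≤ c → ∀ Θ' : Config M × Config M → ℂ, ContDiff ℝ 1 Θ' →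
      E (fun Z => (c : ℂ) * Θ' Z) = ENNReal.ofReal (c ^ 2) * E Θ' :=
    fun c hc Θ' h => form_const_mul μ E hE h c hc
  -- parallelogram identities for `g± = Θ ± Θ ∘ F`
  have hparN := lintegral_nnnorm_add_sub μ hC.continuous hCF.continuous
  rw [hN, hNF, show (2 : ℝ≥0∞) * (1 + 1) = 4 by norm_num] at hparN
  have hparE := form_add_add_sub μ hW E hE hC hCF
  rw [hEF, ← two_mul, ← mul_assoc, show (2 : ℝ≥0∞) * 2 = 4 by norm_num] at hparE
  have htopP : ∫⁻ Z, ((‖Θ Z + Θ (F Z)‖₊ : ℝ≥0∞)) ^ 2 ∂μ ≠ ⊤ :=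
    ne_top_of_le_ne_top (by rw [hparN]; exact ENNReal.ofNat_ne_top) le_self_add
  have htopM : ∫⁻ Z, ((‖Θ Z - Θ (F Z)‖₊ : ℝ≥0∞)) ^ 2 ∂μ ≠ ⊤ :=
    ne_top_of_le_ne_top (by rw [hparN]; exact ENNReal.ofNat_ne_top) le_add_self
  -- symmetric branch: normalise `g₊`
  have keyS : e * ∫⁻ Z, ((‖Θ Z + Θ (F Z)‖₊ : ℝ≥0∞)) ^ 2 ∂μ ≤ E (fun Z => Θ Z + Θ (F Z)) :=
    mul_lintegral_le_form_of_symm μ E hEc F Per hPer e he (hC.add hCF) (hPer (· + ·) Θ _ hP hPF)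
      (fun X Y => by
        show Θ (F (X, Y)) + Θ (F (F (X, Y))) = Θ (X, Y) + Θ (F (X, Y))
        rw [hF, add_comm]) htopP
  -- antisymmetric branch: regularised modulus of `g₋`
  have keyA : e * ∫⁻ Z, ((‖Θ Z - Θ (F Z)‖₊ : ℝ≥0∞)) ^ 2 ∂μ ≤ E (fun Z => Θ Z - Θ (F Z)) :=
    mul_lintegral_le_form_of_antisym μ E hE F Per hPer e he (hC.sub hCF) (hPer (· - ·) Θ _ hP hPF)
      (fun Z => by
        show Θ (F Z) - Θ (F (F Z)) = -(Θ Z - Θ (F Z))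
        rw [hF, neg_sub]) htopM
  -- add up and cancel the factor `4`
  have hsum : e * 4 ≤ 4 * E Θ := by
    calc e * 4 = e * ((∫⁻ Z, ((‖Θ Z + Θ (F Z)‖₊ : ℝ≥0∞)) ^ 2 ∂μ) +
          ∫⁻ Z, ((‖Θ Z - Θ (F Z)‖₊ : ℝ≥0∞)) ^ 2 ∂μ) := by rw [hparN]
      _ = e * (∫⁻ Z, ((‖Θ Z + Θ (F Z)‖₊ : ℝ≥0∞)) ^ 2 ∂μ) +
          e * ∫⁻ Z, ((‖Θ Z - Θ (F Z)‖₊ : ℝ≥0∞)) ^ 2 ∂μ := mul_add _ _ _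
      _ ≤ E (fun Z => Θ Z + Θ (F Z)) + E (fun Z => Θ Z - Θ (F Z)) := add_le_add keyS keyA
      _ = 4 * E Θ := hparE
  rw [mul_comm] at hsum
  exact (ENNReal.mul_le_mul_iff_right (by norm_num) ENNReal.ofNat_ne_top).1 hsum

end SymmetricInfimum

/-! ### The registered stub -/

/-- **Swap invariance ⇒ F-symmetric infimum = absolute infimum** (`stub_symmetricInfimum`, registered signature). [folklore] -/
theorem stub_symmetricInfimum :
    (∀ v : ℝ → ℝ≥0∞, IsRepulsiveFiniteRange v → ∀ (n : ℕ) (L : ℝ) (Θ : Config (n + 1) × Config (n + 1) → ℂ),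
      let C2 : Set (Config (n + 1) × Config (n + 1)) := (cellN (n + 1) L) ×ˢ (cellN (n + 1) L)
      let E2h : (Config (n + 1) × Config (n + 1) → ℂ) → ℝ≥0∞ := fun Θ => ∫⁻ Z in C2,
          (kineticDensity (fun X => Θ (X, Z.2)) Z.1 + kineticDensity (fun Y => Θ (Z.1, Y)) Z.2 +
            (periodicInteraction v L (Fin.tail Z.1) + periodicInteraction v L (Fin.tail Z.2) +
              ∑ j : Fin n, (2 : ENNReal)⁻¹ * (periodizedPotential v L (Z.1 0 - Z.1 j.succ) +
                periodizedPotential v L (Z.2 0 - Z.2 j.succ) + periodizedPotential v L (Z.2 0 - Z.1 j.succ) +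
                periodizedPotential v L (Z.1 0 - Z.2 j.succ))) * (‖Θ Z‖₊ : ENNReal) ^ 2)
      let Adm : (Config (n + 1) × Config (n + 1) → ℂ) → Prop := fun Θ => ContDiff ℝ 1 Θ ∧
          (∀ (Z : Config (n + 1) × Config (n + 1)) (i : Fin (n + 1)) (k : Fin 3),
            Θ (Z.1 + Pi.single i (EuclideanSpace.single k L), Z.2) = Θ Z ∧
              Θ (Z.1, Z.2 + Pi.single i (EuclideanSpace.single k L)) = Θ Z) ∧
          ∫⁻ Z in C2, (‖Θ Z‖₊ : ENNReal) ^ 2 = 1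
      let ΘF : Config (n + 1) × Config (n + 1) → ℂ := fun Z =>
        Θ (Matrix.vecCons (Z.2 0) (Fin.tail Z.1), Matrix.vecCons (Z.1 0) (Fin.tail Z.2))
      Adm Θ → Adm ΘF ∧ E2h ΘF = E2h Θ) →
      ∀ v : ℝ → ℝ≥0∞, IsRepulsiveFiniteRange v → ∀ (n : ℕ) (L : ℝ),
        let C2 : Set (Config (n + 1) × Config (n + 1)) := (cellN (n + 1) L) ×ˢ (cellN (n + 1) L)
        let E2h : (Config (n + 1) × Config (n + 1) → ℂ) → ℝ≥0∞ := fun Θ => ∫⁻ Z in C2,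
          (kineticDensity (fun X => Θ (X, Z.2)) Z.1 + kineticDensity (fun Y => Θ (Z.1, Y)) Z.2 +
            (periodicInteraction v L (Fin.tail Z.1) + periodicInteraction v L (Fin.tail Z.2) +
              ∑ j : Fin n, (2 : ENNReal)⁻¹ * (periodizedPotential v L (Z.1 0 - Z.1 j.succ) +
                periodizedPotential v L (Z.2 0 - Z.2 j.succ) + periodizedPotential v L (Z.2 0 - Z.1 j.succ) +
                periodizedPotential v L (Z.1 0 - Z.2 j.succ))) * (‖Θ Z‖₊ : ENNReal) ^ 2)
        let Adm : (Config (n + 1) × Config (n + 1) → ℂ) → Prop := fun Θ => ContDiff ℝ 1 Θ ∧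
          (∀ (Z : Config (n + 1) × Config (n + 1)) (i : Fin (n + 1)) (k : Fin 3),
            Θ (Z.1 + Pi.single i (EuclideanSpace.single k L), Z.2) = Θ Z ∧
              Θ (Z.1, Z.2 + Pi.single i (EuclideanSpace.single k L)) = Θ Z) ∧
          ∫⁻ Z in C2, (‖Θ Z‖₊ : ENNReal) ^ 2 = 1
        let AdmS : (Config (n + 1) × Config (n + 1) → ℂ) → Prop := fun Θ => ContDiff ℝ 1 Θ ∧
          (∀ (Z : Config (n + 1) × Config (n + 1)) (i : Fin (n + 1)) (k : Fin 3),
            Θ (Z.1 + Pi.single i (EuclideanSpace.single k L), Z.2) = Θ Z ∧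
              Θ (Z.1, Z.2 + Pi.single i (EuclideanSpace.single k L)) = Θ Z) ∧
          (∀ X Y : Config (n + 1), Θ (Matrix.vecCons (Y 0) (Fin.tail X), Matrix.vecCons (X 0) (Fin.tail Y)) = Θ (X, Y)) ∧
          ∫⁻ Z in C2, (‖Θ Z‖₊ : ENNReal) ^ 2 = 1
        (⨅ (Θ' : Config (n + 1) × Config (n + 1) → ℂ) (_ : AdmS Θ'), E2h Θ') =
          ⨅ (Θ' : Config (n + 1) × Config (n + 1) → ℂ) (_ : Adm Θ'), E2h Θ' := by
  intro hSI v hv n L C2 E2h Adm AdmS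
  have hWm := measurable_halfSwapWeight hv.1 n L
  have htail : ∀ (a : Space) (w : Config n), Fin.tail (Matrix.vecCons a w : Config (n + 1)) = w :=
    fun a w => Fin.tail_cons (α := fun _ : Fin (n + 1) => Space) a w
  have key := SymmetricInfimum.iInf_symm_eq_iInf (volume.restrict C2) hWm E2h (fun _ => rfl)
    (fun Z => (Matrix.vecCons (Z.2 0) (Fin.tail Z.1), Matrix.vecCons (Z.1 0) (Fin.tail Z.2)))
    (fun Z => by
      simp only [Matrix.cons_val_zero, htail]
      exact Prod.ext (Fin.cons_self_tail Z.1) (Fin.cons_self_tail Z.2))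
    (fun Θ => ∀ (Z : Config (n + 1) × Config (n + 1)) (i : Fin (n + 1)) (k : Fin 3),
      Θ (Z.1 + Pi.single i (EuclideanSpace.single k L), Z.2) = Θ Z ∧
        Θ (Z.1, Z.2 + Pi.single i (EuclideanSpace.single k L)) = Θ Z)
    (fun G Θ Φ hΘ hΦ Z i k =>
      ⟨by simp only [(hΘ Z i k).1, (hΦ Z i k).1], by simp only [(hΘ Z i k).2, (hΦ Z i k).2]⟩)
    (fun Θ hC hP hN => hSI v hv n L Θ ⟨hC, hP, hN⟩)
  exact key

end Summit.AtomisticToContinuum.BoseEinsteinCondensation.Cruxes.TorusHalfSwapOverlap.Birth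

end
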